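import Summits.QuantumFields.YangMills.Theorems.FluctuationComparisonRegPrIntLS2BetaResidualGauge
import Summits.QuantumFields.YangMills.Theorems.FluctuationComparisonRegPrIntLS2BetaResidualGaugeRooted
import Literature.MathematicalPhysics.QuantumFieldTheory.Balaban1983to89.T3DescentFibreTower
import HarnessLib

/-!
# (RG-K) Structure of the residual gauge group: CENTRE × ROOTED

Fifth (definition-free) file of the RG-K letters for LINE g18-1 `Cruxes/FluctuationComparisonRegPrIntL/Lines/semiclassical_s2beta.lean`
(crux `stmt-QuantumFields-20520`, row LAPLACE ∕ LIMIT).  The v7 docstring of `ResidualGauge` asserts «by the covariance (11) these are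
the `w` whose induced coarse transformation `w̄ = w ∘ emb^{K−J}` is central-constant (`≡ ±1` on `SU(2)`)».  ✓`residual_of_descTransf_eq_const`
(FILE 1) is the easy direction; this file proves the CONVERSE and hence the structure theorem, the group half of LIMIT-INST's `hstab`
(GAP 3: «a residual `w` fixing the base point off the pivots is a central sheet» = THIS FILE ∘ the chart side's ROOTED freeness):

* §1 the torus is connected: a gauge transformation fixing the TRIVIAL field is constant (`gaugeAct_one_eq_one_iff`).
* §2 ★ `exists_descTransf_eq_const_of_residual`: a residual `w` restricts to a CONSTANT `w↓ ≡ g` (test the predicate at `U := 1`,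
  `D_{J,K} 1 = 1` by lit ✓`T3DescentFibreTower.descendTo_one`), and ★★ `descTransf_comm_of_residual`: that constant is CENTRAL (test at the
  gauge copies `(lift v) • 1`, whose descents are the pure gauges `v • 1` by lit ✓`descTransf_liftTransfTo`; two distinct coarse sites).
* §3 ★★ `residual_iff_exists_central` — THE STRUCTURE THEOREM: `w` residual ⟺ `w↓ ≡ c` for a central `c`; and the ROOTED DECOMPOSITION
  `residual w ⟹ ∃ c central, IsResidual (K − J) (c⁻¹ · w)` with `gaugeAct (c⁻¹ · w) = gaugeAct w` (`exists_central_isResidual_of_residual`,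
  `gaugeAct_const_mul_of_comm`) — so a residual stabiliser question reduces to print's rooted sheet, where the chart side's freeness applies.

HONEST: group bookkeeping over landed letters; this file proves NO stub of the line — EXW, GAP♯, LAPLACE (CHART∞ ∕ LIMIT ∕ KNIT ∕ DECAY),
H4ᶜ, LFR♯ᶜ, S2β and crux 20520 stay OPEN; rung R3 (YM₃ on T³) is NOT d = 4, NOT infinite volume, NOT a mass gap, NOT Clay; the Yang–Mills
mass gap is NOT proved.
-/

noncomputable section

open MeasureTheory Filter Topology Set
open Literature.MathematicalPhysics.QuantumFieldTheory.Balaban1983to89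
open Literature.MathematicalPhysics.QuantumFieldTheory.Balaban1983to89.T3ContinuumYM3Torus
open Literature.MathematicalPhysics.QuantumFieldTheory.Balaban1983to89.T3UnitLawDensityEML
open Literature.MathematicalPhysics.QuantumFieldTheory.Balaban1983to89.T3TiltDescent
open Literature.MathematicalPhysics.QuantumFieldTheory.Balaban1983to89.T3PrintedRegularOrbits
open Literature.MathematicalPhysics.QuantumFieldTheory.Balaban1983to89.T3LevelShift
open Literature.MathematicalPhysics.QuantumFieldTheory.Balaban1983to89.T4Continuum
open Literature.MathematicalPhysics.QuantumFieldTheory.Balaban1983to89.B15DeterminingSets (embIter)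
open Literature.MathematicalPhysics.QuantumFieldTheory.Balaban1983to89.B12GaugeOrbits021 (IsResidual)
open scoped Literature.MathematicalPhysics.QuantumFieldTheory.Balaban1983to89.T3OrbitAverage
open Summit.QuantumFields.YangMills.Theorems.FluctuationComparisonRegPrIntLS2BetaResidualGauge
open Summit.QuantumFields.YangMills.Theorems.FluctuationComparisonRegPrIntLS2BetaResidualGaugeRooted

namespace Summit.QuantumFields.YangMills.Theorems.FluctuationComparisonRegPrIntLS2BetaResidualGaugeCentral

/-! ## §1 The torus is connected: the stabiliser of the trivial field is the constants -/

section Torus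

variable {P : Params} {j : ℕ} {G : Type*} [GaugeGroup G]

omit [GaugeGroup G] in
/-- **A GAUGE TRANSFORMATION CONSTANT ALONG EVERY BOND IS CONSTANT** (the torus `T^{(j)}` is connected by unit steps: zero out the
coordinates one at a time, each by iterating the unit step). [cite: Balaban1984PropagatorsI, p.22 (text)] -/
theorem apply_eq_apply_of_forall_bond (u : Site P j → G) (h : ∀ b : PBond P j, u b.src = u b.tgt) (x y : Site P j) : u x = u y := by
  classical
  have hshift : ∀ (z : Site P j) (μ : Fin P.d), u (z.shift μ) = u z := fun z μ => (h ⟨z, μ⟩).symm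
  -- iterate the unit step `m` times in direction `μ`
  have hiter : ∀ (m : ℕ) (z : Site P j) (μ : Fin P.d), u (Function.update z μ (z μ + m)) = u z := by
    intro m
    induction m with
    | zero => intro z μ; rw [Nat.cast_zero, add_zero, Function.update_eq_self]
    | succ m ih =>
      intro z μ
      have hs : Function.update z μ (z μ + ((m + 1 : ℕ) : ZMod (P.sitesPerDir j))) =
          Site.shift (Function.update z μ (z μ + m)) μ := by
        funext i
        by_cases hi : i = μ
        · subst hi
          simp only [Site.shift, Function.update_self, Nat.cast_add, Nat.cast_one]
          ring
        · simp only [Site.shift, Function.update_of_ne hi]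
      rw [hs, hshift, ih]
  -- hence zeroing one coordinate does not change the value
  have hzero : ∀ (z : Site P j) (μ : Fin P.d), u (Function.update z μ 0) = u z := by
    intro z μ
    have hm := hiter ((-(z μ)).val) z μ
    rwa [ZMod.natCast_zmod_val, add_neg_cancel] at hm
  -- zero out any finite set of coordinates
  have hset : ∀ (s : Finset (Fin P.d)) (z : Site P j), u (fun i => if i ∈ s then 0 else z i) = u z := by
    intro s
    induction s using Finset.induction_on with
    | empty => intro z; simp
    | insert μ s hμ ih =>
      intro z
      have hupd : (fun i => if i ∈ insert μ s then (0 : ZMod (P.sitesPerDir j)) else z i) =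
          Function.update (fun i => if i ∈ s then 0 else z i) μ 0 := by
        funext i
        by_cases hi : i = μ
        · subst hi; simp
        · simp [Finset.mem_insert, hi]
      rw [hupd, hzero, ih]
  have hx := hset Finset.univ x
  have hy := hset Finset.univ y
  simp only [Finset.mem_univ, if_true] at hx hy
  rw [← hx, ← hy]

/-- **THE STABILISER OF THE TRIVIAL FIELD IS THE CONSTANTS**: `1^u = 1 ⟺ u` is constant. [cite: Balaban1985Averaging, (8) p.18] -/
theorem gaugeAct_one_eq_one_iff (u : Site P j → G) :
    GaugeField.gaugeAct u (1 : GaugeField P j G) = 1 ↔ ∀ x y : Site P j, u x = u y := by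
  constructor
  · intro h
    refine apply_eq_apply_of_forall_bond u fun b => ?_
    have hb := congrFun h b
    simp only [GaugeField.gaugeAct] at hb
    have hb' : u b.src * (1 : G) * (u b.tgt)⁻¹ = 1 := hb
    rw [mul_one, mul_inv_eq_one] at hb'
    exact hb'
  · intro h
    funext b
    show u b.src * 1 * (u b.tgt)⁻¹ = 1
    rw [mul_one, h b.src b.tgt, mul_inv_cancel]

end Torus

/-! ## §2 A residual transformation restricts to a CENTRAL CONSTANT -/

section Central

variable (F : T3Family) {J K : ℕ} (hJK : J ≤ K)

/-- `D_{J,K} 1 = 1` for the family's `exp[mean log]` averaging (lit `descendTo_one` ∘ `expMeanLogSU_E_one`). [cite: Balaban1987RG1, (0.11) p.253] -/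
theorem descendTo_one_eml :
    descendTo F ℰp J K hJK (1 : GaugeField (F.P K) 0 (Matrix.specialUnitaryGroup (Fin 2) ℂ)) = 1 :=
  T3DescentFibreTower.descendTo_one F ℰp (fun n => T3DescentFibreTower.expMeanLogSU_E_one n) hJK

/-- ★ **A RESIDUAL `w` RESTRICTS TO A CONSTANT `w↓`** (test the residual predicate at `U := 1`: `w↓ • 1 = D(1^w) = D 1 = 1`, then §1).
[cite: Balaban1985Averaging, (11)-(13) p.19] -/
theorem descTransf_apply_eq_of_residual {w : Site (F.P K) 0 → Matrix.specialUnitaryGroup (Fin 2) ℂ}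
    (hw : ∀ U : GaugeField (F.P K) 0 (Matrix.specialUnitaryGroup (Fin 2) ℂ),
      descendTo F ℰp J K hJK (GaugeField.gaugeAct w U) = descendTo F ℰp J K hJK U)
    (x y : Site (F.P J) 0) : descTransf F J K hJK w x = descTransf F J K hJK w y := by
  have h1 := hw 1
  rw [descendTo_gaugeAct, descendTo_one_eml] at h1
  exact (gaugeAct_one_eq_one_iff _).mp h1 x y

/-- The descents of the gauge copies of the trivial field are the coarse PURE GAUGES: `D((lift v) • 1) = v • 1`.
[cite: Balaban1985Averaging, (11)-(12) p.19] -/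
theorem descendTo_gaugeAct_liftTransfTo_one (v : Site (F.P J) 0 → Matrix.specialUnitaryGroup (Fin 2) ℂ) :
    descendTo F ℰp J K hJK (GaugeField.gaugeAct (liftTransfTo F J K hJK v) (1 : GaugeField (F.P K) 0 (Matrix.specialUnitaryGroup (Fin 2) ℂ))) =
      GaugeField.gaugeAct v 1 := by
  rw [descendTo_gaugeAct, descTransf_liftTransfTo, descendTo_one_eml]

/-- The coarse torus of the family has two distinct sites (`2·L^{m+J} ≥ 2` sites per direction, `d = 3 ≥ 1` directions).
[cite: Balaban1987RG1, (0.1) p.251] -/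
theorem exists_site_ne (x₀ : Site (F.P J) 0) : ∃ x₁ : Site (F.P J) 0, x₁ ≠ x₀ := by
  have hd : 0 < (F.P J).d := (F.P J).hd
  refine ⟨x₀.shift ⟨0, hd⟩, fun h => ?_⟩
  have h1 := congrFun h ⟨0, hd⟩
  simp only [Site.shift, Function.update_self] at h1
  have h2 : (1 : ZMod ((F.P J).sitesPerDir 0)) = 0 := by
    have := add_left_cancel (a := x₀ ⟨0, hd⟩) (h1.trans (add_zero _).symm)
    exact this
  haveI : Fact (1 < (F.P J).sitesPerDir 0) := ⟨by
    unfold Params.sitesPerDir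
    have := Nat.one_le_pow ((F.P J).m + (F.P J).K - 0) (F.P J).L (F.P J).L_pos
    omega⟩
  exact one_ne_zero h2

/-- ★★ **THE CONSTANT IS CENTRAL**: for a residual `w` and every `h ∈ SU(2)`, `w↓(x) · h = h · w↓(x)` (test the residual predicate at the
gauge copy `(lift v) • 1` with `v` equal to `1` at one site and to `h` at another: `(v⁻¹ · w↓ · v) • 1 = 1` makes `v⁻¹ w↓ v` constant).
[cite: Balaban1985Averaging, (11)-(13) p.19; Balaban1985Variational, (4) p.278] -/
theorem descTransf_comm_of_residual {w : Site (F.P K) 0 → Matrix.specialUnitaryGroup (Fin 2) ℂ}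
    (hw : ∀ U : GaugeField (F.P K) 0 (Matrix.specialUnitaryGroup (Fin 2) ℂ),
      descendTo F ℰp J K hJK (GaugeField.gaugeAct w U) = descendTo F ℰp J K hJK U)
    (x : Site (F.P J) 0) (h : Matrix.specialUnitaryGroup (Fin 2) ℂ) :
    descTransf F J K hJK w x * h = h * descTransf F J K hJK w x := by
  classical
  obtain ⟨x₁, hx₁⟩ := exists_site_ne F (J := J) x
  set g : Site (F.P J) 0 → Matrix.specialUnitaryGroup (Fin 2) ℂ := descTransf F J K hJK w with hg
  -- the test transformation: `1` at `x`, `h` at `x₁`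
  set v : Site (F.P J) 0 → Matrix.specialUnitaryGroup (Fin 2) ℂ := Function.update (fun _ => 1) x₁ h with hv
  -- residual at `(lift v) • 1`: `g • (v • 1) = v • 1`
  have h1 := hw (GaugeField.gaugeAct (liftTransfTo F J K hJK v) 1)
  rw [descendTo_gaugeAct, descendTo_gaugeAct_liftTransfTo_one] at h1
  -- hence `(v⁻¹ * g * v) • 1 = 1`
  have h2 : GaugeField.gaugeAct (v⁻¹ * g * v) (1 : GaugeField (F.P J) 0 (Matrix.specialUnitaryGroup (Fin 2) ℂ)) = 1 := by
    rw [gaugeAct_mul_eq, gaugeAct_mul_eq, h1, gaugeAct_inv_gaugeAct]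
  have h3 := (gaugeAct_one_eq_one_iff _).mp h2 x x₁
  simp only [Pi.mul_apply, Pi.inv_apply, hv, Function.update_self, Function.update_of_ne hx₁.symm, inv_one, one_mul,
    mul_one] at h3
  -- `h3 : g x = h⁻¹ * g x₁ * h`; and `g` is constant
  have hconst : g x₁ = g x := descTransf_apply_eq_of_residual F hJK hw x₁ x
  rw [hconst] at h3
  calc g x * h = h * (h⁻¹ * g x * h) := by group
    _ = h * g x := by rw [← h3]

/-- ★ **A RESIDUAL `w` RESTRICTS TO A CENTRAL CONSTANT**: `∃ c` central with `w↓ ≡ c`. [cite: Balaban1985Variational, (4) p.278] -/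
theorem exists_descTransf_eq_const_of_residual {w : Site (F.P K) 0 → Matrix.specialUnitaryGroup (Fin 2) ℂ}
    (hw : ∀ U : GaugeField (F.P K) 0 (Matrix.specialUnitaryGroup (Fin 2) ℂ),
      descendTo F ℰp J K hJK (GaugeField.gaugeAct w U) = descendTo F ℰp J K hJK U) :
    ∃ c : Matrix.specialUnitaryGroup (Fin 2) ℂ, (∀ h : Matrix.specialUnitaryGroup (Fin 2) ℂ, c * h = h * c) ∧
      descTransf F J K hJK w = fun _ => c := by
  let x₀ : Site (F.P J) 0 := fun _ => 0
  refine ⟨descTransf F J K hJK w x₀, descTransf_comm_of_residual F hJK hw x₀, funext fun x => ?_⟩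
  exact descTransf_apply_eq_of_residual F hJK hw x x₀

end Central

/-! ## §3 The structure theorem and the rooted decomposition -/

section Structure

variable (F : T3Family) {J K : ℕ} (hJK : J ≤ K)

/-- ★★ **STRUCTURE OF THE RESIDUAL GROUP**: `w` is residual (`D_{J,K}(U^w) = D_{J,K}U` for every `U`) IFF its restriction `w↓` to the
comparison lattice is a CENTRAL CONSTANT (`≡ ±1` on `SU(2)`) — the sentence of the v7 `ResidualGauge` docstring as a kernel fact.
[cite: Balaban1985Variational, (4) p.278; Balaban1985Averaging, (11)-(13) p.19] -/
theorem residual_iff_exists_central {w : Site (F.P K) 0 → Matrix.specialUnitaryGroup (Fin 2) ℂ} :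
    (∀ U : GaugeField (F.P K) 0 (Matrix.specialUnitaryGroup (Fin 2) ℂ),
        descendTo F ℰp J K hJK (GaugeField.gaugeAct w U) = descendTo F ℰp J K hJK U) ↔
      ∃ c : Matrix.specialUnitaryGroup (Fin 2) ℂ, (∀ h : Matrix.specialUnitaryGroup (Fin 2) ℂ, c * h = h * c) ∧
        descTransf F J K hJK w = fun _ => c :=
  ⟨exists_descTransf_eq_const_of_residual F hJK, fun ⟨_, hc, hw⟩ => residual_of_descTransf_eq_const F hJK hc hw⟩

/-- A constant central factor does not change the gauge action: `U^{c·w} = U^{w}`. [cite: Balaban1985Averaging, (8) p.18] -/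
theorem gaugeAct_const_mul_of_comm {P : Params} {j : ℕ} {G : Type*} [GaugeGroup G] {c : G} (hc : ∀ g : G, c * g = g * c)
    (w : Site P j → G) (U : GaugeField P j G) :
    GaugeField.gaugeAct ((fun _ => c) * w : Site P j → G) U = GaugeField.gaugeAct w U := by
  rw [gaugeAct_mul_eq, gaugeAct_const_of_comm hc]

/-- ★★ **ROOTED DECOMPOSITION**: a residual `w` is a central constant times a transformation in PRINT'S ROOTED SHEET —
`IsResidual (K − J) (c⁻¹ · w)` («`= 1` on `T⁽ᴷ⁻ᴶ⁾`», lit `B12GaugeOrbits021.IsResidual`) — and both act identically on fields.  With the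
chart side's rooted freeness («a rooted transformation fixing the base point off the pivots is `1`») this is LIMIT-INST's `hstab`: a
residual stabiliser is a central sheet. [cite: Balaban1987RG1, p.256 (three sentences after (0.21)); Balaban1985Variational, (4) p.278] -/
theorem exists_central_isResidual_of_residual {w : Site (F.P K) 0 → Matrix.specialUnitaryGroup (Fin 2) ℂ}
    (hw : ∀ U : GaugeField (F.P K) 0 (Matrix.specialUnitaryGroup (Fin 2) ℂ),
      descendTo F ℰp J K hJK (GaugeField.gaugeAct w U) = descendTo F ℰp J K hJK U) :
    ∃ c : Matrix.specialUnitaryGroup (Fin 2) ℂ, (∀ h : Matrix.specialUnitaryGroup (Fin 2) ℂ, c * h = h * c) ∧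
      IsResidual (K - J) ((fun _ => c⁻¹) * w : Site (F.P K) 0 → Matrix.specialUnitaryGroup (Fin 2) ℂ) ∧
      ∀ U : GaugeField (F.P K) 0 (Matrix.specialUnitaryGroup (Fin 2) ℂ),
        GaugeField.gaugeAct ((fun _ => c⁻¹) * w : Site (F.P K) 0 → Matrix.specialUnitaryGroup (Fin 2) ℂ) U =
          GaugeField.gaugeAct w U := by
  obtain ⟨c, hc, hwc⟩ := exists_descTransf_eq_const_of_residual F hJK hw
  have hcinv : ∀ g : Matrix.specialUnitaryGroup (Fin 2) ℂ, c⁻¹ * g = g * c⁻¹ := fun g => by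
    rw [inv_mul_eq_iff_eq_mul, ← mul_assoc, hc g, mul_inv_cancel_right]
  refine ⟨c, hc, fun y => ?_, fun U => gaugeAct_const_mul_of_comm hcinv w U⟩
  -- `(c⁻¹ · w)(emb y) = c⁻¹ · w↓(y') = c⁻¹ · c = 1`
  have hy := congrFun hwc ((siteShift (sites_eq F J K hJK)).symm y)
  rw [descTransf_apply, Equiv.apply_symm_apply] at hy
  show c⁻¹ * w (embIter (K - J) y) = 1
  rw [hy, inv_mul_cancel]

end Structure

end Summit.QuantumFields.YangMills.Theorems.FluctuationComparisonRegPrIntLS2BetaResidualGaugeCentral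

end
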